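import Mathlib

/-! # Growth lemma (crux stmt-MatrixMultiplication-10597, route ThinBlockAlpha; refutation line
`refutation-null-chart-9`, stub stub_growth)

We prove that the polynomial × `exp(O(√m))` loss of the hashing/type-count theorem is eventually
dominated by `(7^{7m})^η` for every `η > 0`: concretely, for every `η > 0` there is an `m ≥ 1` with
`(18m+1)^31 · 96 · exp(4 √(log 3 + 18m · log 12)) < (7^{7m})^η`.
The proof is elementary: the left-hand side is at most `exp(486 √m)` for `m ≥ 1`, the right-hand
side equals `exp(7 η log 7 · m)`, and `√m` is eventually smaller than any positive multiple of `m`. -/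

-- `Summit.<Summit>.<Problem>` is the tree's mandated summit-side namespace; for this
-- single-conjunct summit the two coincide, so the file silences `dupNamespace`.
set_option linter.dupNamespace false

noncomputable section

namespace Summit.MatrixMultiplication.MatrixMultiplication.Theorems

/-- For `x ≥ 0` we have `x + 1 ≤ exp (2 √x)`: indeed `x + 1 ≤ (√x + 1)² ≤ exp(√x)²`. -/
theorem growth_add_one_le_exp_two_mul_sqrt {x : ℝ} (hx : 0 ≤ x) :
    x + 1 ≤ Real.exp (2 * Real.sqrt x) := by
  have hsq : Real.sqrt x ^ 2 = x := Real.sq_sqrt hx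
  have hs0 : 0 ≤ Real.sqrt x := Real.sqrt_nonneg x
  calc x + 1 ≤ (Real.sqrt x + 1) ^ 2 := by nlinarith [hsq, hs0]
    _ ≤ (Real.exp (Real.sqrt x)) ^ 2 :=
        pow_le_pow_left₀ (by positivity) (Real.add_one_le_exp _) 2
    _ = Real.exp (2 * Real.sqrt x) := by
        rw [← Real.exp_nat_mul]; norm_num

/-- The left-hand side of the growth inequality is at most `exp (486 √m)` for real `m ≥ 1`. -/
theorem growth_lhs_le_exp {m : ℝ} (hm : 1 ≤ m) :
    (18 * m + 1) ^ 31 * 96 * Real.exp (4 * Real.sqrt (Real.log 3 + 18 * m * Real.log 12))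
      ≤ Real.exp (486 * Real.sqrt m) := by
  set s : ℝ := Real.sqrt m with hs_def
  have hm0 : 0 ≤ m := by linarith
  have hs0 : 0 ≤ s := Real.sqrt_nonneg _
  have hs1 : 1 ≤ s := by rw [hs_def]; exact Real.one_le_sqrt.mpr hm
  have hss : s ^ 2 = m := Real.sq_sqrt hm0
  -- (1) the polynomial factor
  have hsqrt18 : Real.sqrt (18 * m) ≤ 5 * s := by
    rw [Real.sqrt_le_left (by positivity)]
    nlinarith [hss]
  have h1 : 18 * m + 1 ≤ Real.exp (10 * s) :=
    (growth_add_one_le_exp_two_mul_sqrt (by positivity)).trans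
      (Real.exp_le_exp.mpr (by linarith [hsqrt18]))
  have h1' : (18 * m + 1) ^ 31 ≤ Real.exp (310 * s) := by
    calc (18 * m + 1) ^ 31 ≤ (Real.exp (10 * s)) ^ 31 := pow_le_pow_left₀ (by positivity) h1 31
      _ = Real.exp (310 * s) := by rw [← Real.exp_nat_mul]; ring_nf
  -- (2) the constant factor
  have h2 : (96 : ℝ) ≤ Real.exp (96 * s) := by
    calc (96 : ℝ) ≤ 96 + 1 := by norm_num
      _ ≤ Real.exp 96 := Real.add_one_le_exp 96
      _ ≤ Real.exp (96 * s) := Real.exp_le_exp.mpr (by nlinarith)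
  -- (3) the subexponential factor
  have hlog3 : Real.log 3 ≤ 2 := by
    have := Real.log_le_sub_one_of_pos (show (0 : ℝ) < 3 by norm_num); linarith
  have hlog12 : Real.log 12 ≤ 11 := by
    have := Real.log_le_sub_one_of_pos (show (0 : ℝ) < 12 by norm_num); linarith
  have h3 : Real.sqrt (Real.log 3 + 18 * m * Real.log 12) ≤ 20 * s := by
    rw [Real.sqrt_le_left (by positivity)]
    have h18 : 18 * m * Real.log 12 ≤ 18 * m * 11 :=
      mul_le_mul_of_nonneg_left hlog12 (by positivity)
    nlinarith [hss, hlog3, h18, hm]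
  have h3' : Real.exp (4 * Real.sqrt (Real.log 3 + 18 * m * Real.log 12)) ≤ Real.exp (80 * s) :=
    Real.exp_le_exp.mpr (by linarith [h3])
  -- combine
  calc (18 * m + 1) ^ 31 * 96 * Real.exp (4 * Real.sqrt (Real.log 3 + 18 * m * Real.log 12))
      ≤ Real.exp (310 * s) * Real.exp (96 * s) * Real.exp (80 * s) := by
        gcongr
    _ = Real.exp (486 * s) := by
        rw [← Real.exp_add, ← Real.exp_add]; ring_nf

/-- Growth lemma for the refutation of `RectangularThmB`: the polynomial × `exp(O(√m))` loss of the
hashing theorem `exists_free_diagonal_jointType_card` is eventually below `(7^{7m})^η` for every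
`η > 0`. [folklore] -/
theorem stub_growth : ∀ η : ℝ, 0 < η → ∃ m : ℕ, 1 ≤ m ∧
    (((18 * m : ℕ) : ℝ) + 1) ^ 31 * 96 *
        Real.exp (4 * Real.sqrt (Real.log 3 + ((18 * m : ℕ) : ℝ) * Real.log 12))
      < ((7 : ℝ) ^ (7 * m)) ^ η := by
  intro η hη
  have hlog7 : 0 < Real.log 7 := Real.log_pos (by norm_num)
  set c : ℝ := 7 * η * Real.log 7 with hc_def
  have hc : 0 < c := by positivity
  refine ⟨⌈(486 / c) ^ 2⌉₊ + 1, Nat.le_add_left 1 _, ?_⟩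
  set m : ℕ := ⌈(486 / c) ^ 2⌉₊ + 1 with hm_def
  have hm1 : (1 : ℝ) ≤ m := by exact_mod_cast Nat.le_add_left 1 _
  have hm0 : (0 : ℝ) ≤ m := by positivity
  have hmK : (486 / c) ^ 2 < (m : ℝ) := by
    calc (486 / c) ^ 2 ≤ (⌈(486 / c) ^ 2⌉₊ : ℝ) := Nat.le_ceil _
      _ < (⌈(486 / c) ^ 2⌉₊ : ℝ) + 1 := lt_add_one _
      _ = (m : ℝ) := by simp [hm_def]
  -- `s := √m` satisfies `486 < c * s`
  set s : ℝ := Real.sqrt m with hs_def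
  have hs0 : 0 ≤ s := Real.sqrt_nonneg _
  have hss : s ^ 2 = m := Real.sq_sqrt hm0
  have hsK : 486 / c < s := by
    rw [hs_def]; exact (Real.lt_sqrt (by positivity)).mpr hmK
  have h486 : 486 < c * s := by
    have := (div_lt_iff₀ hc).mp hsK
    linarith [mul_comm s c]
  -- rewrite the cast and the right-hand side
  have hn : ((18 * m : ℕ) : ℝ) = 18 * (m : ℝ) := by push_cast; ring
  have hR : ((7 : ℝ) ^ (7 * m)) ^ η = Real.exp (c * m) := by
    rw [Real.rpow_def_of_pos (by positivity), Real.log_pow]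
    congr 1
    push_cast
    rw [hc_def]; ring
  rw [hn, hR]
  refine (growth_lhs_le_exp hm1).trans_lt ?_
  rw [Real.exp_lt_exp, ← hs_def, ← hss]
  have hspos : 0 < s := lt_trans (by positivity : (0 : ℝ) < 486 / c) hsK
  have key : 486 * s < c * s * s := mul_lt_mul_of_pos_right h486 hspos
  nlinarith [key]

end Summit.MatrixMultiplication.MatrixMultiplication.Theorems
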